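import Literature.AnabelianGeometry.SemiGraphs.SubgroupPresentationArithLevels
import Literature.AnabelianGeometry.SemiGraphs.TemperedClosedSubgroupCompact
import HarnessLib

/-!
# The arithmetic level kernels: finiteness modulo `centralMod` ([SemiAnbd] §5, Prop. 5.2 (iv) p. 64,
# Rmk. 5.3.1 p. 65 — bookkeeping for the compactness of the arithmetic vertex groups)

Mochizuki, *Semi-graphs of anabelioids*, Publ. RIMS **42** (2006), §5, Prop. 5.2 (iv) p. 64 ("natural exact
sequences `1 → Π^temp_𝒢 → Π^temp_𝔊 → Π_A → 1`"; the finite étale Galois coverings of `𝔊` have FINITE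
vertical deck groups `Π^temp_𝒢 / Π^temp_{𝒢_j}`) and Rmk. 5.3.1 p. 65 (compactness of `Π^temp_{𝔊,v}`)
[cite: MochizukiSemiAnbd2006, Prop 5.2 (iv), p. 64].

PROOF-ONLY, pure group theory (cell row T54-B, producer debt `HOME/plan/GAP-LEDGER.md` G-w4d053-1;
T54 coordinator lineage abc-iut-w4-d085, exporting the piece (d) of abc-iut-w4-d053's open note of
2026-08-26 04:15Z).  In abc-iut-L3-d4's coset-graph model of the arithmetic tower the level kernel is
`levelKer L = ker (arithAct L) ⊓ ker σ ⊓ centralMod Φ L` (`SubgroupPresentationArithLevels.lean`), and the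
compactness of the arithmetic vertex groups (abc-iut-w4-d053, `TemperedClosedSubgroupCompact.lean`,
`IsTempered.isCompact_of_isClosed_of_finite_image`) needs the stabiliser of a tree-vertex system to have
FINITE image modulo `levelKer L`.  Finiteness modulo `ker (arithAct L)` (finite levels,
`ImmersionLiftUnique.lean`), modulo `ker σ` (finite `Aut 𝔾`) and modulo `aug⁻¹ U`
(`finite_image_quotient_comap`) being in the tree, this file supplies the remaining factor:

* `finite_quotient_centralMod` — if the `Φ`-stable normal level `L ≤ Γ` has FINITE index, then
  `E ⧸ centralMod Φ L` is finite: `e ↦ (y L ↦ Φ_e(y) L)` is a well-defined injection of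
  `E ⧸ centralMod Φ L` into the finite type `Γ ⧸ L → Γ ⧸ L` (the group-theoretic content of "the
  vertical deck transformations of a finite étale covering are finite in number": `E` moves `Γ ⧸ L`
  through a finite permutation group);
* `finite_image_quotient_centralMod` — hence EVERY subset of `E` has finite image modulo `centralMod Φ L`;
* `finite_image_quotient_levelKer` — with abc-iut-w4-d053's `finite_image_quotient_inf`: the image of
  `S ⊆ E` modulo `levelKer L` is finite as soon as its images modulo `ker (arithAct L)` and modulo
  `ker σ` are.

Nothing here refers to the IUT corpus; no side is taken on [IUTchIII] Cor 3.12; typed ≠ proved.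
-/

namespace Literature.AnabelianGeometry.SemiGraphs

namespace SemiGraph

namespace SubgroupPresentation

open CategoryTheory

universe u v

variable {𝔾 : SemiGraph.{u}} {Γ : Type u} [Group Γ] {E : Type v} [Group E]
variable {Φ : E →* MulAut Γ}

/-- Congruence modulo a `Φ`-stable normal `L` is respected by every `Φ_e`: if `a⁻¹ b ∈ L` then
`(Φ_e a)⁻¹ (Φ_e b) ∈ L`. [cite: MochizukiSemiAnbd2006, Prop 5.2 (iv), p. 64] -/
theorem inv_mul_mem_of_apply (L : Subgroup Γ) (hL : ∀ (e : E) (x : Γ), x ∈ L → Φ e x ∈ L) (e : E)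
    {a b : Γ} (h : a⁻¹ * b ∈ L) : (Φ e a)⁻¹ * Φ e b ∈ L := by
  simpa only [map_mul, map_inv] using hL e _ h

/-- The action of `e ∈ E` on the coset SET `Γ ⧸ L` of a `Φ`-stable normal level: `y L ↦ Φ_e(y) L`
(well defined by stability). [cite: MochizukiSemiAnbd2006, Prop 5.2 (iv), p. 64] -/
theorem exists_quotientAction (L : Subgroup Γ) [L.Normal]
    (hL : ∀ (e : E) (x : Γ), x ∈ L → Φ e x ∈ L) (e : E) :
    ∃ f : Γ ⧸ L → Γ ⧸ L, ∀ y : Γ, f (QuotientGroup.mk y) = QuotientGroup.mk (Φ e y) := by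
  refine ⟨Quotient.map' (Φ e) (fun a b h => ?_), fun y => rfl⟩
  rw [QuotientGroup.leftRel_apply] at h ⊢
  exact inv_mul_mem_of_apply L hL e h

/-- Two elements of `E` that induce the same map on `Γ ⧸ L` are congruent modulo `centralMod Φ L`:
if `Φ_e(y) L = Φ_{e'}(y) L` for all `y`, then `e⁻¹ e' ∈ centralMod Φ L`.
[cite: MochizukiSemiAnbd2006, Prop 5.2 (iv), p. 64] -/
theorem inv_mul_mem_centralMod_of_forall_mk_eq (L : Subgroup Γ) [L.Normal]
    (hL : ∀ (e : E) (x : Γ), x ∈ L → Φ e x ∈ L) {e e' : E}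
    (h : ∀ y : Γ, (QuotientGroup.mk (Φ e y) : Γ ⧸ L) = QuotientGroup.mk (Φ e' y)) :
    e⁻¹ * e' ∈ centralMod Φ L := by
  rw [mem_centralMod_iff]
  intro y
  -- `(Φ_e y)⁻¹ (Φ_{e'} y) ∈ L`; apply `Φ_{e⁻¹}` and conjugate by `y`
  have h1 : (Φ e y)⁻¹ * Φ e' y ∈ L := by rw [← QuotientGroup.eq]; exact h y
  have h2 : y⁻¹ * Φ (e⁻¹ * e') y ∈ L := by
    have := inv_mul_mem_of_apply L hL e⁻¹ h1
    simpa only [map_mul, map_inv, MulAut.mul_apply, MulAut.inv_apply, MulEquiv.symm_apply_apply,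
      ← MulAut.mul_apply, inv_mul_cancel, MulAut.one_apply] using this
  have h3 : y * (y⁻¹ * Φ (e⁻¹ * e') y) * y⁻¹ ∈ L := Subgroup.Normal.conj_mem inferInstance _ h2 y
  simpa only [mul_assoc, mul_inv_cancel_left] using h3

/-- **`E ⧸ centralMod Φ L` is finite when the `Φ`-stable normal level `L` has finite index**: the
classes of `E` modulo `centralMod Φ L` inject into the finite type of self-maps of `Γ ⧸ L`
(`e ↦ (y L ↦ Φ_e(y) L)`) — "the vertical deck transformations of a finite étale covering are finite
in number". [cite: MochizukiSemiAnbd2006, Prop 5.2 (iv), p. 64] -/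
theorem finite_quotient_centralMod (L : Subgroup Γ) [L.Normal] [Finite (Γ ⧸ L)]
    (hL : ∀ (e : E) (x : Γ), x ∈ L → Φ e x ∈ L) : Finite (E ⧸ centralMod Φ L) := by
  classical
  -- the induced self-map of `Γ ⧸ L`, chosen for each `e`
  choose f hf using exists_quotientAction L hL
  -- it is constant on classes modulo `centralMod Φ L`
  have hconst : ∀ e e' : E, (QuotientGroup.mk e : E ⧸ centralMod Φ L) = QuotientGroup.mk e' →
      f e = f e' := by
    intro e e' hee
    rw [QuotientGroup.eq, mem_centralMod_iff] at hee
    funext q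
    induction q using QuotientGroup.induction_on with
    | H y =>
      rw [hf, hf, QuotientGroup.eq]
      -- `(Φ_e y)⁻¹ Φ_{e'} y = Φ_e (y⁻¹ Φ_{e⁻¹ e'} y) ∈ L`
      have hy : y⁻¹ * Φ (e⁻¹ * e') y ∈ L := by
        have := Subgroup.Normal.conj_mem inferInstance _ (hee y) y⁻¹
        simpa only [inv_inv, mul_assoc, inv_mul_cancel, mul_one] using this
      have := hL e _ hy
      simpa only [map_mul, map_inv, MulAut.mul_apply, MulAut.inv_apply, ← MulAut.mul_apply,
        mul_inv_cancel_left, MulEquiv.apply_symm_apply] using this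
  -- descend to the quotient and conclude by injectivity into a finite type
  let F : E ⧸ centralMod Φ L → (Γ ⧸ L → Γ ⧸ L) :=
    Quotient.lift f fun e e' (hee : QuotientGroup.leftRel _ e e') =>
      hconst e e' (Quotient.sound hee)
  refine Finite.of_injective F fun q q' hqq => ?_
  induction q using QuotientGroup.induction_on with
  | H e =>
    induction q' using QuotientGroup.induction_on with
    | H e' =>
      rw [QuotientGroup.eq]
      refine inv_mul_mem_centralMod_of_forall_mk_eq L hL fun y => ?_
      have hF : f e = f e' := hqq
      rw [← hf e y, ← hf e' y, hF]

/-- Every subset of `E` has finite image modulo `centralMod Φ L`, for a `Φ`-stable normal level of finite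
index. [cite: MochizukiSemiAnbd2006, Prop 5.2 (iv), p. 64] -/
theorem finite_image_quotient_centralMod (L : Subgroup Γ) [L.Normal] [Finite (Γ ⧸ L)]
    (hL : ∀ (e : E) (x : Γ), x ∈ L → Φ e x ∈ L) (S : Set E) :
    ((QuotientGroup.mk : E → E ⧸ centralMod Φ L) '' S).Finite :=
  haveI := finite_quotient_centralMod L hL
  Set.toFinite _

variable (P : SubgroupPresentation 𝔾 Γ) {σ : E →* Aut 𝔾}

/-- **Finite image modulo the full arithmetic level kernel** `levelKer L = ker (arithAct L) ⊓ ker σ ⊓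
centralMod Φ L` (abc-iut-L3-d4): for a `Φ`-stable normal level of finite index, the image of `S ⊆ E`
modulo `levelKer L` is finite as soon as its images modulo `ker (arithAct L)` (finite levels) and modulo
`ker σ` (finite `Aut 𝔾`) are — abc-iut-w4-d053's `finite_image_quotient_inf` twice, the third factor
being `finite_image_quotient_centralMod`.  The tower input of the compactness of the arithmetic vertex
groups (Rmk. 5.3.1). [cite: MochizukiSemiAnbd2006, Rmk 5.3.1, p. 65] -/
theorem finite_image_quotient_levelKer (hP : P.IsArithCompatible Φ σ) (L : Subgroup Γ) [L.Normal]
    [Finite (Γ ⧸ L)] (hL : ∀ (e : E) (x : Γ), x ∈ L → Φ e x ∈ L) (S : Set E)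
    (hact : ((QuotientGroup.mk : E → E ⧸ (P.arithAct hP L hL).ker) '' S).Finite)
    (hσ : ((QuotientGroup.mk : E → E ⧸ σ.ker) '' S).Finite) :
    ((QuotientGroup.mk : E → E ⧸ P.levelKer hP L hL) '' S).Finite :=
  finite_image_quotient_inf (finite_image_quotient_inf hact hσ) (finite_image_quotient_centralMod L hL S)

end SubgroupPresentation

end SemiGraph

end Literature.AnabelianGeometry.SemiGraphs
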